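import Mathlib.Algebra.Star.SelfAdjoint
import Mathlib.Analysis.Complex.Basic
import Summits.Ventures.HodgeRepro2.T5HilbertSymbolNorm
import Summits.Ventures.HodgeRepro2.T5HermitianDetClass

/-!
# The norm of a quadratic star algebra is the Hilbert norm form `z² − θ y²` (cell pub-hodge-repro2, seat p3)

Tier-5 N2 support, rows N2.2.2 / N2.8.1 of route/T5-N2-route-3.md. File 133 states O'Meara's «α is a local norm
iff `(α, θ) = 1`» with the norm written as `z² − θ y²` on the base field; file 134 states the determinant-class
invariant with the norm written as `star u · u` in the quadratic star algebra `E`. This file identifies the two: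
for a field `E` with involution and an element `s` with `star s = −s` such that every element is `a + b s` with
`a, b` star-fixed (`IsQuadraticStar s` — e.g. `E = F(√θ)` with `s = √θ`, or `ℂ` with `s = I`), and `F` the
self-adjoint subfield `selfAdjoint E`:
* `star_mul_self_add_mul`: `N(a + b s) = star (a + b s) · (a + b s) = a² − (s·s) b²`;
* **`isUnitNorm_iff_isNormSqrt`**: for star-fixed `θ = s·s` and `α`, `IsUnitNorm α ⟺ α ≠ 0 ∧ IsNormSqrt θ α`;
* **`hilbertSolvable_iff_isUnitNorm`**: hence, in characteristic `≠ 2`, `(α, θ) = 1 ⟺ α = star u · u` for a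
  unit `u` of `E` — O'Meara §65A with the norm read in `E` itself; with file 136 (`isCongruent_iff_exists_det_eq`
  modulo `(U)`) this makes row N2.8.1 (i)'s «`W₁₂,v ≅ W₃₄,v ⟺ (c, θ/v) = 1`» one kernel chain at a non-split `v`
  once the route's `E_v = F⁺_v(√θ)` (files 119–120) is fed in;
* non-vacuity: `isQuadraticStar_I : IsQuadraticStar Complex.I` (every `z = re + im·I`).
Mathlib + files 133 / 134 only. No display; no device. §8(d): uses an L-value-free non-vanishing device: NO.
-/

namespace Summit.Ventures.HodgeRepro2.T5QuadraticStarNorm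

open Summit.Ventures.HodgeRepro2.T5HilbertSymbolNorm
open Summit.Ventures.HodgeRepro2.T5HermitianDetClass

section General

variable {E : Type*} [Field E] [StarRing E]

/-- `E` is a quadratic star algebra over its self-adjoint subfield with generator `s`: `star s = −s` and every
element is `a + b s` with `a, b` star-fixed. -/
def IsQuadraticStar (s : E) : Prop :=
  star s = -s ∧ ∀ x : E, ∃ a b : E, star a = a ∧ star b = b ∧ x = a + b * s

/-- `N(a + b s) = a² − (s·s) b²` for star-fixed `a, b`. -/
theorem star_mul_self_add_mul {s : E} (hs : star s = -s) {a b : E} (ha : star a = a) (hb : star b = b) :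
    star (a + b * s) * (a + b * s) = a ^ 2 - (s * s) * b ^ 2 := by
  rw [star_add, star_mul, hs, ha, hb]
  ring

/-- The coercion of `2`. -/
theorem val_two : ((2 : selfAdjoint E) : E) = 2 := rfl

/-- `2 ≠ 0` in `E` gives `2 ≠ 0` in the self-adjoint subfield. -/
theorem two_ne_zero_selfAdjoint (h2 : (2 : E) ≠ 0) : (2 : selfAdjoint E) ≠ 0 := by
  intro h
  apply h2
  have := congrArg Subtype.val h
  simpa [val_two] using this

/-- **The norm of the quadratic star algebra is the Hilbert norm form.** For `θ = s·s` and `α` in the self-adjoint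
subfield `F = selfAdjoint E`: `α` is the norm `star u · u` of a unit `u ∈ E` iff `α ≠ 0` and `α = z² − θ y²` for
some `z, y ∈ F`. -/
theorem isUnitNorm_iff_isNormSqrt {s : E} (h : IsQuadraticStar s) {θ : selfAdjoint E} (hθ : (θ : E) = s * s)
    (α : selfAdjoint E) : IsUnitNorm (α : E) ↔ (α ≠ 0 ∧ IsNormSqrt θ α) := by
  obtain ⟨hs, hspan⟩ := h
  constructor
  · rintro ⟨u, hu, hα⟩
    obtain ⟨a, b, ha, hb, rfl⟩ := hspan u
    refine ⟨?_, ⟨⟨a, ha⟩, ⟨b, hb⟩, ?_⟩⟩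
    · intro h0
      rw [h0, AddSubgroup.coe_zero] at hα
      exact (isUnit_iff_ne_zero.mp hu) (by
        rcases mul_eq_zero.mp hα.symm with h | h
        · exact star_eq_zero.mp h
        · exact h)
    · apply Subtype.ext
      rw [hα, star_mul_self_add_mul hs ha hb]
      simp [hθ]
  · rintro ⟨hα0, z, y, hzy⟩
    have hval : (α : E) = star ((z : E) + (y : E) * s) * ((z : E) + (y : E) * s) := by
      rw [star_mul_self_add_mul hs z.2 y.2, ← hθ, hzy]
      simp
    refine ⟨(z : E) + (y : E) * s, ?_, hval⟩
    rw [isUnit_iff_ne_zero]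
    intro h0
    apply hα0
    apply Subtype.ext
    rw [hval, h0, mul_zero, AddSubgroup.coe_zero]

/-- **O'Meara §65A with the norm read in `E`**: in characteristic `≠ 2`, for `θ = s·s ≠ 0` and `α ≠ 0` in the
self-adjoint subfield, `(α, θ) = 1` (file 133's `HilbertSolvable`) iff `α = star u · u` for a unit `u` of `E`. -/
theorem hilbertSolvable_iff_isUnitNorm {s : E} (h : IsQuadraticStar s) (h2 : (2 : E) ≠ 0)
    {θ α : selfAdjoint E} (hθ : (θ : E) = s * s) (hθ0 : θ ≠ 0) (hα0 : α ≠ 0) :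
    HilbertSolvable α θ ↔ IsUnitNorm (α : E) := by
  haveI : NeZero (2 : selfAdjoint E) := ⟨two_ne_zero_selfAdjoint h2⟩
  rw [hilbertSolvable_iff_isNormSqrt hα0 hθ0, isUnitNorm_iff_isNormSqrt h hθ α]
  exact ⟨fun hn => ⟨hα0, hn⟩, fun hn => hn.2⟩

/-- A non-norm of `E` is a `(·, θ) = −1` value, and conversely (the two readings of «non-norm» agree). -/
theorem not_hilbertSolvable_iff_not_isUnitNorm {s : E} (h : IsQuadraticStar s) (h2 : (2 : E) ≠ 0)
    {θ α : selfAdjoint E} (hθ : (θ : E) = s * s) (hθ0 : θ ≠ 0) (hα0 : α ≠ 0) :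
    ¬ HilbertSolvable α θ ↔ ¬ IsUnitNorm (α : E) := by
  rw [hilbertSolvable_iff_isUnitNorm h h2 hθ hθ0 hα0]

end General

section Complex

/-- `ℂ` is a quadratic star algebra over `ℝ` with generator `I`: `conj I = −I` and `z = re z + im z · I`. -/
theorem isQuadraticStar_I : IsQuadraticStar (Complex.I) := by
  refine ⟨by simp, fun z => ⟨(z.re : ℂ), (z.im : ℂ), Complex.conj_ofReal _, Complex.conj_ofReal _, ?_⟩⟩
  exact (Complex.re_add_im z).symm

end Complex

end Summit.Ventures.HodgeRepro2.T5QuadraticStarNorm
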